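import Summits.ABC.StewartYu.PadicG3Lambda
import HarnessLib

/-!
# Cell abc-stewartyu, crux `Y07Odd` (stmt-ABC-19658), line `gen3-slab-odd`: the SMALLNESS-EXPONENT LINE —
# `‖Λ/b_{j₀}‖_p ≤ p^{−E}` for every natural `E ≥ 1` the negated bound can pay for

`Summits/ABC/StewartYu/PadicG3ExpLine.lean` — cell `abc-stewartyu` (seat p2-g4, F-odd lead).  Theorems only, no named fact.

Every family of the inequality pack `IneqPackR₃` (`PadicG3RecordR3`) has a `Λ`-branch
`BwP·‖Λ/b_{j₀}‖·p^{(t−1)/2}·p^{condExp}`; p5-g4's generic glue (`PadicG3OddLines.h*_of_lines`) consumes ONE exponent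
`E` with `‖S.Λ/(S.b S.j₀)‖ ≤ (p^E)⁻¹` and per-family arithmetic `… ≤ E`.  This file supplies that exponent from the
crux context: under the NEGATED bound `¬ ord_p(∏ αⱼ^{bⱼ} − 1)·log p ≤ R` (any real `R`) and the weight bound
`log max(3,|bⱼ|) ≤ W`, every natural `E ≥ 1` with `E·log p + W ≤ R` satisfies `‖Λ/b_{j₀}‖ ≤ p^{−E}`
(`expLine_of_negBound`): `ord_p(b_{j₀})·log p ≤ log|b_{j₀}| ≤ W`, so `E + ord_p(b_{j₀}) < ord_p(∏ αⱼ^{bⱼ} − 1)`, and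
`PadicG3Lambda.norm_Λ_div_le_of_padicValRat` converts the order into the norm (`∏ αⱼ^{bⱼ} ≠ 1` because `R > 0`).
Convenience forms: `expLine_of_negBound₂` (`2·E·log p ≤ R` and `2·W ≤ R`), `expLine_of_negBound_of_le` (a real budget
`B ≥ E·log p` with `B + W ≤ R`), `expLine_budget` (the exponent CHOSEN as `E := ⌈B/log p⌉` from a budget `B` with
`2B ≤ R`, `W + log p ≤ B`: then `B ≤ E·log p ≤ B + log p`), and the order facts alone (`prod_ne_one_of_negBound`,
`ord_b_mul_log_le`, `ordLine_of_negBound_E`).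

References: K. Yu, Acta Math. 211 (2013) §7 (the `Λ`-order line); Yu. V. Nesterenko, LNM 1819 (2003) §4.2.
-/

noncomputable section

open Finset

namespace Summit.ABC.StewartYu

namespace G3Setup

variable {p : ℕ} [Fact p.Prime] (S : G3Setup p)

/-- `ord_p(b_{j₀})·log p ≤ W` when `log max(3, |b_{j₀}|) ≤ W` (`p^{ord} ∣ b_{j₀} ≠ 0`). [folklore] -/
theorem ord_b_mul_log_le {W : ℝ} (hWb : Real.log (max 3 (|S.b S.j₀| : ℝ)) ≤ W) :
    (padicValInt p (S.b S.j₀) : ℝ) * Real.log p ≤ W := by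
  have hp : p.Prime := Fact.out
  set v : ℕ := padicValInt p (S.b S.j₀) with hvdef
  have hb0 : S.b S.j₀ ≠ 0 := S.bj₀_ne
  have hdvd : p ^ v ∣ (S.b S.j₀).natAbs := by rw [hvdef]; unfold padicValInt; exact pow_padicValNat_dvd
  have hle : p ^ v ≤ (S.b S.j₀).natAbs := Nat.le_of_dvd (Int.natAbs_pos.mpr hb0) hdvd
  have hleR : (p : ℝ) ^ v ≤ |(S.b S.j₀ : ℝ)| := by
    rw [← Int.cast_abs, ← Nat.cast_natAbs]; exact_mod_cast hle
  have hpv : (0 : ℝ) < (p : ℝ) ^ v := by have := hp.pos; positivity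
  calc (v : ℝ) * Real.log p = Real.log ((p : ℝ) ^ v) := by rw [Real.log_pow]
    _ ≤ Real.log |(S.b S.j₀ : ℝ)| := Real.log_le_log hpv hleR
    _ ≤ Real.log (max 3 (|S.b S.j₀| : ℝ)) := by
        rw [← Int.cast_abs]
        refine Real.log_le_log (by rw [Int.cast_abs]; exact lt_of_lt_of_le hpv hleR) ?_
        push_cast; exact le_max_right _ _
    _ ≤ W := hWb

/-- `0 < W` when `log max(3, |b_{j₀}|) ≤ W`. [folklore] -/
theorem W_pos_of_hWb {W : ℝ} (hWb : Real.log (max 3 (|S.b S.j₀| : ℝ)) ≤ W) : 0 < W := by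
  have h3 : Real.log 3 ≤ Real.log (max 3 (|S.b S.j₀| : ℝ)) :=
    Real.log_le_log (by norm_num) (le_max_left _ _)
  have hlog3 : 0 < Real.log 3 := Real.log_pos (by norm_num)
  linarith

/-- Under the negated bound `¬ ord_p(∏ αⱼ^{bⱼ} − 1)·log p ≤ R` with `0 ≤ R`: `∏ αⱼ^{bⱼ} ≠ 1`. [cite: Yu2013, §7; shape only] -/
theorem prod_ne_one_of_negBound {R : ℝ} (hR : 0 ≤ R)
    (hU : ¬ (padicValRat p (∏ j, S.α j ^ S.b j - 1) : ℝ) * Real.log p ≤ R) :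
    ∏ j, S.α j ^ S.b j ≠ 1 := by
  intro h1
  apply hU
  rw [h1, sub_self, padicValRat.zero]
  push_cast
  rw [zero_mul]
  exact hR

/-- **The smallness-exponent line.**  Under the negated bound `¬ ord_p(∏ αⱼ^{bⱼ} − 1)·log p ≤ R` and
`log max(3,|bⱼ|) ≤ W`: every natural `E ≥ 1` with `E·log p + W ≤ R` has `‖Λ/b_{j₀}‖_p ≤ (p^E)⁻¹`.
[cite: Yu2013, §7; shape only] -/
theorem expLine_of_negBound {W : ℝ} (hWb : ∀ j, Real.log (max 3 (|S.b j| : ℝ)) ≤ W) {R : ℝ}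
    (hU : ¬ (padicValRat p (∏ j, S.α j ^ S.b j - 1) : ℝ) * Real.log p ≤ R)
    {E : ℕ} (hE1 : 1 ≤ E) (hE : (E : ℝ) * Real.log p + W ≤ R) :
    ‖S.Λ / (S.b S.j₀ : ℚ_[p])‖ ≤ ((p : ℝ) ^ E)⁻¹ := by
  have hp : p.Prime := Fact.out
  have hp1 : (1 : ℝ) < p := by exact_mod_cast hp.one_lt
  have hlogp : 0 < Real.log p := Real.log_pos hp1
  have hW : 0 < W := S.W_pos_of_hWb (hWb S.j₀)
  have hR : 0 ≤ R := by
    have : (0 : ℝ) ≤ (E : ℝ) * Real.log p := by positivity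
    linarith
  have hne : ∏ j, S.α j ^ S.b j ≠ 1 := S.prod_ne_one_of_negBound hR hU
  set U : ℤ := padicValRat p (∏ j, S.α j ^ S.b j - 1) with hUdef
  have hUlt : R < (U : ℝ) * Real.log p := by push Not at hU; exact hU
  set v : ℕ := padicValInt p (S.b S.j₀) with hvdef
  have hv : (v : ℝ) * Real.log p ≤ W := S.ord_b_mul_log_le (hWb S.j₀)
  have hk : (((E : ℤ) + (v : ℤ) : ℤ) : ℝ) * Real.log p < (U : ℝ) * Real.log p := by
    push_cast
    rw [add_mul]
    linarith
  have hk' : (((E : ℤ) + (v : ℤ) : ℤ) : ℝ) < (U : ℝ) := lt_of_mul_lt_mul_right hk hlogp.le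
  have hk'' : (E : ℤ) + (v : ℤ) < U := by exact_mod_cast hk'
  have hord : (E : ℤ) + padicValInt p (S.b S.j₀) ≤ padicValRat p (∏ j, S.α j ^ S.b j - 1) := by
    rw [← hvdef, ← hUdef]; exact hk''.le
  have h := S.norm_Λ_div_le_of_padicValRat hE1 hne hord
  rwa [inv_pow] at h

/-- **The smallness-exponent line, halved budget form**: `2·(E·log p) ≤ R` and `2·W ≤ R` suffice.
[cite: Yu2013, §7; shape only] -/
theorem expLine_of_negBound₂ {W : ℝ} (hWb : ∀ j, Real.log (max 3 (|S.b j| : ℝ)) ≤ W) {R : ℝ}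
    (hU : ¬ (padicValRat p (∏ j, S.α j ^ S.b j - 1) : ℝ) * Real.log p ≤ R)
    {E : ℕ} (hE1 : 1 ≤ E) (hE : 2 * ((E : ℝ) * Real.log p) ≤ R) (hWR : 2 * W ≤ R) :
    ‖S.Λ / (S.b S.j₀ : ℚ_[p])‖ ≤ ((p : ℝ) ^ E)⁻¹ :=
  S.expLine_of_negBound hWb hU hE1 (by linarith)

/-- **The smallness-exponent line, real-budget form**: if a REAL quantity `B` dominates `E·log p` and `B + W ≤ R`, then
`‖Λ/b_{j₀}‖ ≤ (p^E)⁻¹` — the shape in which the record's budget lemmas (zeros × gain `≤ B`) are stated.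
[cite: Yu2013, §7; shape only] -/
theorem expLine_of_negBound_of_le {W : ℝ} (hWb : ∀ j, Real.log (max 3 (|S.b j| : ℝ)) ≤ W) {R : ℝ}
    (hU : ¬ (padicValRat p (∏ j, S.α j ^ S.b j - 1) : ℝ) * Real.log p ≤ R)
    {E : ℕ} (hE1 : 1 ≤ E) {B : ℝ} (hEB : (E : ℝ) * Real.log p ≤ B) (hB : B + W ≤ R) :
    ‖S.Λ / (S.b S.j₀ : ℚ_[p])‖ ≤ ((p : ℝ) ^ E)⁻¹ :=
  S.expLine_of_negBound hWb hU hE1 (by linarith)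

/-- **The smallness-exponent line with the exponent CHOSEN from a budget**: if `2·B ≤ R` and `W + log p ≤ B`, then
`E := ⌈B/log p⌉` has `1 ≤ E`, `B ≤ E·log p ≤ B + log p` and `‖Λ/b_{j₀}‖ ≤ (p^E)⁻¹` — the record takes
`B :=` its zeros × gain headline (`8·2ⁿ·(G·X·L)` resp. `8·2ⁿ·Zp + CondFloorV n`). [cite: Yu2013, §7; shape only] -/
theorem expLine_budget {W : ℝ} (hWb : ∀ j, Real.log (max 3 (|S.b j| : ℝ)) ≤ W) {R : ℝ}
    (hU : ¬ (padicValRat p (∏ j, S.α j ^ S.b j - 1) : ℝ) * Real.log p ≤ R)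
    {B : ℝ} (hB2 : 2 * B ≤ R) (hWB : W + Real.log p ≤ B) :
    ∃ E : ℕ, 1 ≤ E ∧ ‖S.Λ / (S.b S.j₀ : ℚ_[p])‖ ≤ ((p : ℝ) ^ E)⁻¹ ∧ B ≤ (E : ℝ) * Real.log p ∧
      (E : ℝ) * Real.log p ≤ B + Real.log p := by
  have hp : p.Prime := Fact.out
  have hp1 : (1 : ℝ) < p := by exact_mod_cast hp.one_lt
  have hlogp : 0 < Real.log p := Real.log_pos hp1
  have hW : 0 < W := S.W_pos_of_hWb (hWb S.j₀)
  have hB : 0 < B := by linarith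
  set E : ℕ := ⌈B / Real.log p⌉₊ with hEdef
  have hEge : B / Real.log p ≤ (E : ℝ) := Nat.le_ceil _
  have hElt : (E : ℝ) < B / Real.log p + 1 := Nat.ceil_lt_add_one (div_nonneg hB.le hlogp.le)
  have hBE : B ≤ (E : ℝ) * Real.log p := by
    have := mul_le_mul_of_nonneg_right hEge hlogp.le
    rwa [div_mul_cancel₀ _ hlogp.ne'] at this
  have hEB : (E : ℝ) * Real.log p ≤ B + Real.log p := by
    have := mul_le_mul_of_nonneg_right hElt.le hlogp.le
    rw [add_mul, div_mul_cancel₀ _ hlogp.ne', one_mul] at this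
    exact this
  have hE1 : 1 ≤ E := by
    have h1 : (1 : ℝ) ≤ B / Real.log p := by
      rw [le_div_iff₀ hlogp, one_mul]; linarith
    have : (1 : ℝ) ≤ (E : ℝ) := h1.trans hEge
    exact_mod_cast this
  exact ⟨E, hE1, S.expLine_of_negBound hWb hU hE1 (by linarith), hBE, hEB⟩

/-- The order form of the line (for consumers that want `ord_p` rather than the norm): under the negated bound,
`E + ord_p(b_{j₀}) ≤ ord_p(∏ αⱼ^{bⱼ} − 1)` for every natural `E` with `E·log p + W ≤ R`. [cite: Yu2013, §7; shape only] -/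
theorem ordLine_of_negBound_E {W : ℝ} (hWb : ∀ j, Real.log (max 3 (|S.b j| : ℝ)) ≤ W) {R : ℝ}
    (hU : ¬ (padicValRat p (∏ j, S.α j ^ S.b j - 1) : ℝ) * Real.log p ≤ R)
    {E : ℕ} (hE : (E : ℝ) * Real.log p + W ≤ R) :
    (E : ℤ) + padicValInt p (S.b S.j₀) ≤ padicValRat p (∏ j, S.α j ^ S.b j - 1) := by
  have hp : p.Prime := Fact.out
  have hp1 : (1 : ℝ) < p := by exact_mod_cast hp.one_lt
  have hlogp : 0 < Real.log p := Real.log_pos hp1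
  set U : ℤ := padicValRat p (∏ j, S.α j ^ S.b j - 1) with hUdef
  have hUlt : R < (U : ℝ) * Real.log p := by push Not at hU; exact hU
  set v : ℕ := padicValInt p (S.b S.j₀) with hvdef
  have hv : (v : ℝ) * Real.log p ≤ W := S.ord_b_mul_log_le (hWb S.j₀)
  have hk : (((E : ℤ) + (v : ℤ) : ℤ) : ℝ) * Real.log p < (U : ℝ) * Real.log p := by
    push_cast
    rw [add_mul]
    linarith
  have hk' : (((E : ℤ) + (v : ℤ) : ℤ) : ℝ) < (U : ℝ) := lt_of_mul_lt_mul_right hk hlogp.le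
  have hk'' : (E : ℤ) + (v : ℤ) < U := by exact_mod_cast hk'
  exact hk''.le

end G3Setup

end Summit.ABC.StewartYu

end
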